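import Summits.KontsevichZagierPeriods.KontsevichZagierPeriods.Theorems.GrothendieckSectorComplementRingJoin

/-!
# Kernel certificates: the normal form of a sector landing of Conjecture 1
# (rider R3 of `Cruxes/SectorComplement/STUB-PLAN-stub_ringRemainder.md`; crux `Grothendieck.SectorComplement`,
# stmt-KontsevichZagierPeriods-11102)

Conjecture 1 of Kontsevich–Zagier in kernel form ON A SECTOR is injectivity of `evalP : P →+* ℝ` on a
subring `ℤ[v] ⊆ P` of the formal period ring generated by a family `v` of formal periods. Every sector
landed so far has the same two ingredients — (N) a NUMERICAL statement about the values `evalP ∘ v`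
(transcendence / algebraic independence / the exact ideal of numerical relations) and (C) CHAINS of
moves realising each generating relation inside `P` — glued by elementary commutative algebra. This file
lands that algebra once, as reusable API (the ideal-certificate normal form of stub-ideation k2 for
`stub_ringRemainder`, ranked R3 by the stub critic):

* §1 bookkeeping: `evalP` commutes with integer polynomial evaluation (`evalP_aeval_eq`); the sector
  `Subring.closure (range v)` is the image of `aeval v` (`mem_closure_range_iff`), so the closure-form
  kernel statement used by the stubs is the polynomial-form one (`kernel_closure_iff_aeval`);
* §2 **`kernel_of_certificate`** (N + C ⇒ kernel): if a set `G ⊆ ℤ[X]` generates an ideal containing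
  every numerical relation of the values and every member of `G` is realised in `P` by moves, then
  Conjecture 1 holds on the sector; **`kernel_of_algebraicIndependent`** (height `0`: a free family of
  values roots a sector with no chain at all — the shape of `stub_piLineKernel`, `kPiRingKernel`);
* §3 **`kernel_adjoin_of_monic`** (the tower step over a NON-free base, companion of the landed
  saturation lemma `stub_saturationKernel`): adjoining `t` to a subring `R₀` keeps injectivity of
  `evalP`, provided `t` satisfies in `P` a MONIC relation `L` over `R₀` (C) and no polynomial over `R₀`
  of smaller degree kills the NUMBER `evalP t` unless it is zero (N) — the shape of the Legendre sector
  (`lemniscaticSectorGlue_proof`: `L = z − (4xy − 2x²)`, degree `1` over `ℤ[κ, ε]`).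

It organises sector landings; it does not move the stub `stub_ringRemainder`, which is the Statement
itself (`stub_ringRemainder_iff_summit`). No definitions, no named-fact hypotheses; axioms standard.

References: M. Kontsevich, D. Zagier, *Periods* (2001), §1.2 (Conjecture 1), §4.1.
-/

noncomputable section

open Set
open Literature.NumberTheory.Transcendental
open Literature.NumberTheory.Transcendental.KZ
open MvPolynomial (aeval X C)

namespace Summit.KontsevichZagierPeriods.Grothendieck.SectorComplementRingJoin

/-! ## §1 Bookkeeping -/

/-- **`evalP ∘ aeval v = aeval (evalP ∘ v)`** on integer polynomials: both are ring maps
`ℤ[X_σ] → ℝ` agreeing on the variables. [folklore] -/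
theorem evalP_aeval_eq {σ : Type*} (v : σ → FormalPeriodRing) (P : MvPolynomial σ ℤ) :
    evalP (aeval v P) = aeval (fun i => evalP (v i)) P := by
  have h : evalP.comp (aeval v : MvPolynomial σ ℤ →ₐ[ℤ] FormalPeriodRing).toRingHom =
      (aeval (fun i => evalP (v i)) : MvPolynomial σ ℤ →ₐ[ℤ] ℝ).toRingHom :=
    MvPolynomial.ringHom_ext (fun z => by simp) (fun i => by simp)
  exact RingHom.congr_fun h P

/-- **The sector `ℤ[v]` is the image of `aeval v`**: an element of the subring generated by the family
`v` is an integer polynomial expression in the `v i`, and conversely. [folklore] -/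
theorem mem_closure_range_iff {σ : Type*} (v : σ → FormalPeriodRing) (x : FormalPeriodRing) :
    x ∈ Subring.closure (Set.range v) ↔ ∃ P : MvPolynomial σ ℤ, aeval v P = x := by
  constructor
  · intro hx
    induction hx using Subring.closure_induction with
    | mem y hy =>
      obtain ⟨i, rfl⟩ := hy
      exact ⟨X i, MvPolynomial.aeval_X v i⟩
    | zero => exact ⟨0, map_zero _⟩
    | one => exact ⟨1, map_one _⟩
    | add x y _ _ hx hy =>
      obtain ⟨P, rfl⟩ := hx
      obtain ⟨Q, rfl⟩ := hy
      exact ⟨P + Q, map_add _ _ _⟩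
    | neg x _ hx =>
      obtain ⟨P, rfl⟩ := hx
      exact ⟨-P, map_neg _ _⟩
    | mul x y _ _ hx hy =>
      obtain ⟨P, rfl⟩ := hx
      obtain ⟨Q, rfl⟩ := hy
      exact ⟨P * Q, map_mul _ _ _⟩
  · rintro ⟨P, rfl⟩
    induction P using MvPolynomial.induction_on with
    | C a =>
      rw [MvPolynomial.algHom_C, algebraMap_int_eq, eq_intCast]
      exact intCast_mem _ a
    | add p q hp hq => rw [map_add]; exact Subring.add_mem _ hp hq
    | mul_X p i hp =>
      rw [map_mul, MvPolynomial.aeval_X]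
      exact Subring.mul_mem _ hp (Subring.subset_closure ⟨i, rfl⟩)

/-- **Closure form ↔ polynomial form** of Conjecture 1 in kernel form on the sector `ℤ[v]`:
injectivity of `evalP` on `Subring.closure (range v)` is the statement
"`evalP (aeval v P) = 0 ⇒ aeval v P = 0` for every integer polynomial `P`". [folklore] -/
theorem kernel_closure_iff_aeval {σ : Type*} (v : σ → FormalPeriodRing) :
    (∀ x ∈ Subring.closure (Set.range v), evalP x = 0 → x = 0) ↔
      ∀ P : MvPolynomial σ ℤ, evalP (aeval v P) = 0 → aeval v P = 0 :=
  ⟨fun h P hP => h _ ((mem_closure_range_iff v _).2 ⟨P, rfl⟩) hP, fun h x hx hx0 => by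
    obtain ⟨P, rfl⟩ := (mem_closure_range_iff v x).1 hx
    exact h P hx0⟩

/-! ## §2 Certificates: (N) numerical relations + (C) chains ⇒ the sector kernel -/

/-- **IDEAL CERTIFICATE ⇒ CONJECTURE 1 ON THE SECTOR.** If a set `G` of integer polynomials generates
an ideal containing every NUMERICAL relation among the values `evalP (v i)` (N), and every member of
`G` is realised in the formal period ring by moves, `aeval v Q = 0` (C), then `evalP` is injective on
`ℤ[v]`: `P ∈ span G ≤ ker (aeval v)`. [cite: KontsevichZagier2001, §1.2, Conjecture 1] -/
theorem kernel_of_certificate {σ : Type*} (v : σ → FormalPeriodRing) (G : Set (MvPolynomial σ ℤ))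
    (hN : ∀ P : MvPolynomial σ ℤ, aeval (fun i => evalP (v i)) P = 0 → P ∈ Ideal.span G)
    (hC : ∀ Q ∈ G, aeval v Q = 0) :
    ∀ x ∈ Subring.closure (Set.range v), evalP x = 0 → x = 0 := by
  refine (kernel_closure_iff_aeval v).2 fun P hP => ?_
  rw [evalP_aeval_eq] at hP
  have hle : Ideal.span G ≤
      RingHom.ker (aeval v : MvPolynomial σ ℤ →ₐ[ℤ] FormalPeriodRing).toRingHom :=
    Ideal.span_le.2 fun Q hQ => RingHom.mem_ker.2 (hC Q hQ)
  exact RingHom.mem_ker.1 (hle (hN P hP))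

/-- **Conversely, the sector kernel is the certificate with `G` = all realised relations** (so the
certificate form loses nothing): if `evalP` is injective on `ℤ[v]`, every numerical relation of the
values is itself realised in `P`. [folklore] -/
theorem aeval_eq_zero_of_kernel {σ : Type*} (v : σ → FormalPeriodRing)
    (h : ∀ x ∈ Subring.closure (Set.range v), evalP x = 0 → x = 0) (P : MvPolynomial σ ℤ)
    (hP : aeval (fun i => evalP (v i)) P = 0) : aeval v P = 0 :=
  (kernel_closure_iff_aeval v).1 h P (by rw [evalP_aeval_eq, hP])

/-- **HEIGHT ZERO: a free family of values roots a sector with no chain at all.** If the values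
`evalP (v i)` are algebraically independent over `ℚ`, then `evalP` is injective on `ℤ[v]` (the only
numerical relation is `0`; certificate `G = ∅`). The shape of `stub_piLineKernel` (Lindemann) and
`kPiRingKernel` (Chudnovsky). [cite: KontsevichZagier2001, §1.2, Conjecture 1] -/
theorem kernel_of_algebraicIndependent {σ : Type*} (v : σ → FormalPeriodRing)
    (hind : AlgebraicIndependent ℚ (fun i => evalP (v i))) :
    ∀ x ∈ Subring.closure (Set.range v), evalP x = 0 → x = 0 := by
  refine kernel_of_certificate v ∅ (fun P hP => ?_) (fun Q hQ => hQ.elim)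
  have hq : MvPolynomial.map (algebraMap ℤ ℚ) P = 0 := by
    apply hind
    rw [MvPolynomial.aeval_map_algebraMap, map_zero]
    exact hP
  have hP0 : P = 0 :=
    MvPolynomial.map_injective (algebraMap ℤ ℚ) (algebraMap ℤ ℚ).injective_int
      (by rw [hq, map_zero])
  rw [hP0]
  exact Ideal.zero_mem _

/-! ## §3 The tower step over a non-free base: adjoining a root of a monic relation -/

/-- Elements of `R₀[t] ⊆ P` are polynomial expressions in `t` with coefficients in `R₀`. [folklore] -/
theorem exists_polynomial_eval₂_eq (R₀ : Subring FormalPeriodRing) (t : FormalPeriodRing)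
    {x : FormalPeriodRing} (hx : x ∈ Subring.closure ((R₀ : Set FormalPeriodRing) ∪ {t})) :
    ∃ Q : Polynomial R₀, Polynomial.eval₂RingHom R₀.subtype t Q = x := by
  induction hx using Subring.closure_induction with
  | mem y hy =>
    rcases hy with hy | hy
    · exact ⟨Polynomial.C ⟨y, hy⟩, by simp⟩
    · rw [Set.mem_singleton_iff] at hy
      subst hy
      exact ⟨Polynomial.X, by simp⟩
  | zero => exact ⟨0, map_zero _⟩
  | one => exact ⟨1, map_one _⟩
  | add a b _ _ ha hb =>
    obtain ⟨A, rfl⟩ := ha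
    obtain ⟨B, rfl⟩ := hb
    exact ⟨A + B, map_add _ _ _⟩
  | neg a _ ha =>
    obtain ⟨A, rfl⟩ := ha
    exact ⟨-A, map_neg _ _⟩
  | mul a b _ _ ha hb =>
    obtain ⟨A, rfl⟩ := ha
    obtain ⟨B, rfl⟩ := hb
    exact ⟨A * B, map_mul _ _ _⟩

/-- **THE TOWER STEP OVER A NON-FREE BASE** (companion of the saturation lemma `stub_saturationKernel`,
which is the case `L = n·X − r₀`). Let `R₀ ⊆ P` be a subring and `t ∈ P`. Suppose (C) `t` satisfies in
`P` a MONIC relation `L ∈ R₀[X]`, `L(t) = 0` (realised by moves), and (N) no polynomial over `R₀` of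
degree `< deg L` kills the NUMBER `evalP t` numerically unless it is the zero polynomial (i.e. `deg L`
is the degree of `evalP t` over the numbers `evalP R₀`, and `evalP` is injective on `R₀`-coefficients).
Then `evalP` is injective on `R₀[t]`. Proof: write `x = Q(t)`, `Q = (Q mod L) + L·(Q div L)`
(`Polynomial.modByMonic_add_div`), so `x = (Q mod L)(t)` with `deg (Q mod L) < deg L`; if `evalP x = 0`
the remainder kills `evalP t` numerically, hence vanishes. The shape of the Legendre sector
(`lemniscaticSectorGlue_proof`: `R₀ = ℤ[κ, ε]`, `t = ϖ`, `L = X − (4κε − 2κ²)`).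
[cite: KontsevichZagier2001, §1.2, Conjecture 1; §4.1] -/
theorem kernel_adjoin_of_monic :
    ∀ (R₀ : Subring FormalPeriodRing) (t : FormalPeriodRing) (L : Polynomial R₀), L.Monic →
      (∀ R : Polynomial R₀, R.degree < L.degree →
        (R.map (evalP.comp R₀.subtype)).eval (evalP t) = 0 → R = 0) →
      Polynomial.eval₂ R₀.subtype t L = 0 →
      ∀ x ∈ Subring.closure ((R₀ : Set FormalPeriodRing) ∪ {t}), evalP x = 0 → x = 0 := by
  intro R₀ t L hL hmin hrel x hx hx0
  obtain ⟨Q, rfl⟩ := exists_polynomial_eval₂_eq R₀ t hx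
  rw [Polynomial.coe_eval₂RingHom] at hx0 ⊢
  have hQ : Q %ₘ L + L * (Q /ₘ L) = Q := Polynomial.modByMonic_add_div Q L
  have hx' : Polynomial.eval₂ R₀.subtype t Q = Polynomial.eval₂ R₀.subtype t (Q %ₘ L) := by
    conv_lhs => rw [← hQ]
    rw [Polynomial.eval₂_add, Polynomial.eval₂_mul, hrel, zero_mul, add_zero]
  rw [hx'] at hx0 ⊢
  have hdeg : (Q %ₘ L).degree < L.degree := Polynomial.degree_modByMonic_lt Q hL
  have hnum : ((Q %ₘ L).map (evalP.comp R₀.subtype)).eval (evalP t) = 0 := by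
    rw [Polynomial.eval_map, ← Polynomial.hom_eval₂, hx0]
  rw [hmin _ hdeg hnum, Polynomial.eval₂_zero]

end Summit.KontsevichZagierPeriods.Grothendieck.SectorComplementRingJoin

end
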